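import Mathlib.MeasureTheory.Measure.CharacteristicFunction.Basic
import Mathlib.Analysis.Complex.CauchyIntegral
import Mathlib.Analysis.Complex.Convex
import Mathlib.Analysis.Analytic.IsolatedZeros
import Mathlib.Analysis.SpecificLimits.Basic
import Literature.Analysis.Complex.HolomorphicParametricIntegral
import Literature.MathematicalPhysics.QuantumFieldTheory.OSReconstructionNoE1
import HarnessLib

/-!
# Uniqueness of the joint spectral measure of `(H, P⃗)` — Laplace–Fourier uniqueness on `{p₀ ≥ 0}`

Topic `Literature/MathematicalPhysics/QuantumFieldTheory`. Theorems only: no definitions, no named facts.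

`OSReconstructionNoE1.lean` reconstructs, from a labelled Schwinger family with reflection positivity and
translation invariance on `⁰𝒮`, the contraction semigroup `e^{-tH} = h.transfer t` and the unitary spatial
translations `U(a⃗) = h.translate a`, and packages the spectral content of this commuting pair in the
predicate `h.IsJointSpectralMeasure ψ μ`: `μ` is a finite measure on momentum space `ℝ^d`, carried by
`{p₀ ≥ 0}`, with `⟪ψ, e^{-tH} U(a⃗) ψ⟫ = ∫ e^{−t p₀ + i⟨a⃗,p⃗⟩} dμ(p)` for `t ≥ 0`, `a⁰ = 0` (existence:
`OSReconstructionNoE1Proofs.exists_isJointSpectralMeasure_holds`). That file lists "uniqueness of the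
joint spectral measure (Laplace–Fourier uniqueness)" as not done; this file proves it, together with the
quadratic-form calculus of `ψ ↦ μ_ψ` **as measures**, which is what measure-class (support) statements
about the energy–momentum spectrum need in order to pass to linear combinations and limits of vectors.

* `LaplaceFourierHalfSpace.*` — the Laplace–Fourier transform `z ↦ ∫ e^{−z p₀ + i⟨a,p⟩} dμ(p)` of a finite
  measure on `ℝ^d` carried by `{p₀ ≥ 0}`: the kernel bound `|e^{−z p₀ + i⟨a,p⟩}| = e^{−(Re z) p₀} ≤ 1`,
  holomorphy on `Re z > 0` (`differentiableOn_integral`, by the dominated holomorphic parameter integral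
  `Literature.Analysis.Complex.differentiableOn_integral_of_dominated`), continuity on `Re z ≥ 0`
  (`continuousOn_integral`, dominated convergence), the characteristic function as a boundary value
  (`charFun_eq_integral`: `charFun μ ξ` is the transform at `a = ξ − ξ₀e₀`, `z = −iξ₀`), and
  **uniqueness** (`measure_ext`): two finite measures carried by `{p₀ ≥ 0}` with the same data
  `∫ e^{−t p₀ + i⟨a,p⟩} dμ` for all `t ≥ 0` and all `a` with `a⁰ = 0` are equal — identity theorem on the
  right half-plane from the real points `1 + 1/(n+1)` (`AnalyticOnNhd.eqOn_of_preconnected_of_frequently_eq`),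
  continuity to the imaginary axis along `z + 1/(n+1)`, Lévy's theorem `Measure.ext_of_charFun`.
* `OSReconstructionNoE1.IsJointSpectralMeasure.unique` — two joint spectral measures of one vector are
  equal; `.eq_jointSpectralMeasure` — every joint spectral measure of `ψ` is the chosen
  `h.jointSpectralMeasure ψ`; `.measure_univ` — `μ_ψ(ℝ^d) = ‖ψ‖²` in `ℝ≥0∞`; `.integrable` — the kernel is
  `μ_ψ`-integrable; `.add_parallelogram` — **parallelogram law** `μ_{ψ+φ} + μ_{ψ−φ} = 2 • (μ_ψ + μ_φ)`;
  `.eq_smul` — **scaling law** `μ_{cψ} = ‖c‖² • μ_ψ`; `.smul` — `‖c‖² • μ_ψ` is a joint spectral measure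
  of `c • ψ`.

On the operator side these are the scalar measures `⟨ψ, E(·)ψ⟩` of the product projection-valued measure
of the strongly commuting self-adjoint family `(H, P⃗)` (Reed–Simon I, Thm. VIII.12), for which
uniqueness and the quadratic dependence on `ψ` are immediate; here only the Euclidean generating function
`(t, a⃗) ↦ ⟪ψ, e^{-tH} U(a⃗) ψ⟫` is available, and the passage from `e^{-tH}` (`t ≥ 0`) to `e^{isH}` is
the one-variable identity theorem plus continuity up to the imaginary axis. Everything is folklore.

## References
* M. Reed, B. Simon, *Methods of Modern Mathematical Physics I* (rev. ed. 1980), Thm. VIII.12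
  (joint spectral measure of commuting self-adjoint operators) [ReedSimonI1980].
* K. Osterwalder, R. Schrader, *Axioms for Euclidean Green's functions*, CMP 31 (1973), §4.1, p. 92
  (`T_t = e^{-tH}`, `U(a) = T^{ia⁰} U_s(a⃗)`) [OsterwalderSchraderCMP1973].
-/

noncomputable section

open _root_.MeasureTheory _root_.Complex Set Filter
open _root_.Topology
open scoped InnerProductSpace ComplexConjugate NNReal ENNReal
open Literature.MathematicalPhysics.AQFT

namespace Literature.MathematicalPhysics.QuantumFieldTheory

universe u

/-! ## The Laplace–Fourier transform of a finite measure on the half-space `{p₀ ≥ 0}` -/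

namespace LaplaceFourierHalfSpace

variable {d : ℕ} [NeZero d]

/-- `|e^{−z p₀ + i⟨a,p⟩}| = e^{−(Re z) p₀}`. [folklore] -/
theorem norm_kernel (z : ℂ) (a p : EuclideanSpace ℝ (Fin d)) :
    ‖cexp (-(z * ((p 0 : ℝ) : ℂ)) + ((⟪a, p⟫_ℝ : ℝ) : ℂ) * I)‖ = Real.exp (-(z.re * p 0)) := by
  rw [Complex.norm_exp]
  congr 1
  simp

/-- `|e^{−z p₀ + i⟨a,p⟩}| ≤ 1` for `Re z ≥ 0` and `p₀ ≥ 0`. [folklore] -/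
theorem norm_kernel_le_one {z : ℂ} (hz : 0 ≤ z.re) (a : EuclideanSpace ℝ (Fin d))
    {p : EuclideanSpace ℝ (Fin d)} (hp : 0 ≤ p 0) :
    ‖cexp (-(z * ((p 0 : ℝ) : ℂ)) + ((⟪a, p⟫_ℝ : ℝ) : ℂ) * I)‖ ≤ 1 := by
  rw [norm_kernel, Real.exp_le_one_iff, neg_nonpos]
  exact mul_nonneg hz hp

/-- The kernel `p ↦ e^{−z p₀ + i⟨a,p⟩}` is continuous in the momentum. [folklore] -/
theorem continuous_kernel (z : ℂ) (a : EuclideanSpace ℝ (Fin d)) :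
    Continuous fun p : EuclideanSpace ℝ (Fin d) =>
      cexp (-(z * ((p 0 : ℝ) : ℂ)) + ((⟪a, p⟫_ℝ : ℝ) : ℂ) * I) := by
  fun_prop

/-- The kernel `z ↦ e^{−z p₀ + i⟨a,p⟩}` is entire in the complex time. [folklore] -/
theorem differentiable_kernel (a p : EuclideanSpace ℝ (Fin d)) :
    Differentiable ℂ fun z : ℂ => cexp (-(z * ((p 0 : ℝ) : ℂ)) + ((⟪a, p⟫_ℝ : ℝ) : ℂ) * I) := by
  fun_prop

/-- A measure carried by `{p₀ ≥ 0}` (`μ {p₀ < 0} = 0`) has `p₀ ≥ 0` almost everywhere. [folklore] -/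
theorem ae_nonneg_apply_zero (μ : Measure (EuclideanSpace ℝ (Fin d))) (hE : μ {p | p 0 < 0} = 0) :
    ∀ᵐ p ∂μ, 0 ≤ p 0 := by
  rw [ae_iff]
  simpa only [not_le] using hE

omit [NeZero d] in
/-- A point of the ball `B(τ₀, Re τ₀)` has positive real part. [folklore] -/
theorem re_pos_of_mem_ball {τ₀ τ : ℂ} (hτ : τ ∈ Metric.ball τ₀ τ₀.re) : 0 < τ.re := by
  rw [Metric.mem_ball, dist_eq_norm] at hτ
  have h1 := abs_re_le_norm (τ - τ₀)
  rw [Complex.sub_re] at h1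
  have h2 := (abs_lt.1 (h1.trans_lt hτ)).1
  linarith

/-- **Holomorphy.** The Laplace–Fourier transform `z ↦ ∫ e^{−z p₀ + i⟨a,p⟩} dμ(p)` of a finite measure
carried by `{p₀ ≥ 0}` is holomorphic on the open right half-plane `Re z > 0` (dominated holomorphic
parameter integral, majorant `1`). [folklore] -/
theorem differentiableOn_integral (μ : Measure (EuclideanSpace ℝ (Fin d))) [IsFiniteMeasure μ]
    (hE : μ {p | p 0 < 0} = 0) (a : EuclideanSpace ℝ (Fin d)) :
    DifferentiableOn ℂ
      (fun z : ℂ => ∫ p, cexp (-(z * ((p 0 : ℝ) : ℂ)) + ((⟪a, p⟫_ℝ : ℝ) : ℂ) * I) ∂μ)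
      {z : ℂ | 0 < z.re} := by
  refine Literature.Analysis.Complex.differentiableOn_integral_of_dominated
    (fun z _ => (continuous_kernel z a).aestronglyMeasurable)
    (Eventually.of_forall fun p => (differentiable_kernel a p).differentiableOn)
    fun τ₀ hτ₀ => ?_
  refine ⟨τ₀.re, hτ₀, fun τ hτ => re_pos_of_mem_ball hτ, fun _ => 1, integrable_const _, ?_⟩
  filter_upwards [ae_nonneg_apply_zero μ hE] with p hp
  intro τ hτ
  exact norm_kernel_le_one (re_pos_of_mem_ball hτ).le a hp

/-- **Continuity up to the boundary.** The Laplace–Fourier transform of a finite measure carried by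
`{p₀ ≥ 0}` is continuous on the closed right half-plane `Re z ≥ 0` (dominated convergence, majorant `1`).
[folklore] -/
theorem continuousOn_integral (μ : Measure (EuclideanSpace ℝ (Fin d))) [IsFiniteMeasure μ]
    (hE : μ {p | p 0 < 0} = 0) (a : EuclideanSpace ℝ (Fin d)) :
    ContinuousOn
      (fun z : ℂ => ∫ p, cexp (-(z * ((p 0 : ℝ) : ℂ)) + ((⟪a, p⟫_ℝ : ℝ) : ℂ) * I) ∂μ)
      {z : ℂ | 0 ≤ z.re} := by
  refine continuousOn_of_dominated (fun z _ => (continuous_kernel z a).aestronglyMeasurable)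
    (fun z hz => ?_) (integrable_const (1 : ℝ))
    (ae_of_all _ fun p => (differentiable_kernel a p).continuous.continuousOn)
  filter_upwards [ae_nonneg_apply_zero μ hE] with p hp using norm_kernel_le_one hz a hp

/-- Real points of the transform, in the normal form of `IsJointSpectralMeasure.inner_transfer_translate`:
`∫ e^{−t p₀ + i⟨a,p⟩} dμ` with the exponent cast from `ℝ`. [folklore] -/
theorem integral_ofReal (μ : Measure (EuclideanSpace ℝ (Fin d))) (a : EuclideanSpace ℝ (Fin d))
    (t : ℝ) :
    (∫ p, cexp (-((t : ℂ) * ((p 0 : ℝ) : ℂ)) + ((⟪a, p⟫_ℝ : ℝ) : ℂ) * I) ∂μ) =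
      ∫ p, cexp ((((-(t * p 0)) : ℝ) : ℂ) + ((⟪a, p⟫_ℝ : ℝ) : ℂ) * I) ∂μ := by
  refine integral_congr_ae (ae_of_all _ fun p => ?_)
  push_cast
  ring_nf

/-- **The characteristic function is a boundary value of the Laplace–Fourier transform**:
`charFun μ ξ = ∫ e^{i⟨p,ξ⟩} dμ = ∫ e^{−z p₀ + i⟨a,p⟩} dμ` at the spatial vector `a = ξ − ξ₀e₀` and the
imaginary time `z = −iξ₀`. [folklore] -/
theorem charFun_eq_integral (μ : Measure (EuclideanSpace ℝ (Fin d))) (ξ : EuclideanSpace ℝ (Fin d)) :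
    charFun μ ξ = ∫ p, cexp (-((-(((ξ 0 : ℝ) : ℂ) * I)) * ((p 0 : ℝ) : ℂ)) +
      ((⟪ξ - (ξ 0) • EuclideanSpace.single 0 1, p⟫_ℝ : ℝ) : ℂ) * I) ∂μ := by
  rw [charFun_apply]
  refine integral_congr_ae (ae_of_all _ fun p => ?_)
  have hinner : ⟪ξ - (ξ 0) • EuclideanSpace.single (0 : Fin d) (1 : ℝ), p⟫_ℝ = ⟪p, ξ⟫_ℝ - ξ 0 * p 0 := by
    rw [inner_sub_left, inner_smul_left, EuclideanSpace.inner_single_left, real_inner_comm]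
    simp
  simp only [hinner]
  congr 1
  push_cast
  ring

/-- **Identity theorem and passage to the boundary.** Two Laplace–Fourier transforms of finite measures
carried by `{p₀ ≥ 0}` (same spatial vector `a`) that agree at the real times `t > 0` agree on the whole
closed right half-plane `Re z ≥ 0`: both are holomorphic on `Re z > 0` and agree on the real points
`1 + 1/(n+1) → 1`, hence on the (preconnected) open half-plane; both are continuous on `Re z ≥ 0`, and
`z + 1/(n+1) → z` from inside. [folklore] -/
theorem integral_eq_of_eq_ofReal {μ ν : Measure (EuclideanSpace ℝ (Fin d))} [IsFiniteMeasure μ]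
    [IsFiniteMeasure ν] (hEμ : μ {p | p 0 < 0} = 0) (hEν : ν {p | p 0 < 0} = 0)
    (a : EuclideanSpace ℝ (Fin d))
    (hreal : ∀ t : ℝ, 0 < t →
      (∫ p, cexp (-((t : ℂ) * ((p 0 : ℝ) : ℂ)) + ((⟪a, p⟫_ℝ : ℝ) : ℂ) * I) ∂μ) =
        ∫ p, cexp (-((t : ℂ) * ((p 0 : ℝ) : ℂ)) + ((⟪a, p⟫_ℝ : ℝ) : ℂ) * I) ∂ν)
    {z : ℂ} (hz : 0 ≤ z.re) :
    (∫ p, cexp (-(z * ((p 0 : ℝ) : ℂ)) + ((⟪a, p⟫_ℝ : ℝ) : ℂ) * I) ∂μ) =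
      ∫ p, cexp (-(z * ((p 0 : ℝ) : ℂ)) + ((⟪a, p⟫_ℝ : ℝ) : ℂ) * I) ∂ν := by
  set f : ℂ → ℂ := fun z => ∫ p, cexp (-(z * ((p 0 : ℝ) : ℂ)) + ((⟪a, p⟫_ℝ : ℝ) : ℂ) * I) ∂μ with hf
  set g : ℂ → ℂ := fun z => ∫ p, cexp (-(z * ((p 0 : ℝ) : ℂ)) + ((⟪a, p⟫_ℝ : ℝ) : ℂ) * I) ∂ν with hg
  show f z = g z
  -- Step 1: the open half-plane (identity theorem from the real points `1 + 1/(n+1)`)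
  have hU : IsOpen {τ : ℂ | 0 < τ.re} := isOpen_lt continuous_const Complex.continuous_re
  have hUc : IsPreconnected {τ : ℂ | 0 < τ.re} := (convex_halfSpace_re_gt 0).isPreconnected
  have hfa : AnalyticOnNhd ℂ f {τ : ℂ | 0 < τ.re} := (differentiableOn_integral μ hEμ a).analyticOnNhd hU
  have hga : AnalyticOnNhd ℂ g {τ : ℂ | 0 < τ.re} := (differentiableOn_integral ν hEν a).analyticOnNhd hU
  have h1 : ((1 : ℝ) : ℂ) ∈ {τ : ℂ | 0 < τ.re} := by simp
  have hfreq : ∃ᶠ w in 𝓝[≠] ((1 : ℝ) : ℂ), f w = g w := by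
    set u : ℕ → ℂ := fun n => (((1 + 1 / ((n : ℝ) + 1) : ℝ)) : ℂ) with hu
    have hut : Tendsto u atTop (𝓝[≠] ((1 : ℝ) : ℂ)) := by
      rw [tendsto_nhdsWithin_iff]
      refine ⟨?_, Eventually.of_forall fun n => ?_⟩
      · have h1 : Tendsto (fun n : ℕ => (1 : ℝ) + 1 / ((n : ℝ) + 1)) atTop (𝓝 (1 + 0)) :=
          (tendsto_const_nhds (x := (1 : ℝ)) (f := (atTop : Filter ℕ))).add
            tendsto_one_div_add_atTop_nhds_zero_nat
        rw [add_zero] at h1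
        exact (Complex.continuous_ofReal.tendsto 1).comp h1
      · simp only [hu, Set.mem_compl_iff, Set.mem_singleton_iff, Complex.ofReal_inj]
        have : 0 < 1 / ((n : ℝ) + 1) := by positivity
        linarith
    have hall : ∀ n, f (u n) = g (u n) := fun n => hreal _ (by positivity)
    exact hut.frequently (Frequently.of_forall hall)
  have hopen : EqOn f g {τ : ℂ | 0 < τ.re} := hfa.eqOn_of_preconnected_of_frequently_eq hga hUc h1 hfreq
  -- Step 2: the boundary, by continuity on the closed half-plane along `z + 1/(n+1)`
  set u : ℕ → ℂ := fun n => z + (((1 / ((n : ℝ) + 1) : ℝ)) : ℂ) with hu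
  have hu_mem : ∀ n, u n ∈ {τ : ℂ | 0 < τ.re} := by
    intro n
    have : 0 < 1 / ((n : ℝ) + 1) := by positivity
    simp only [hu, Set.mem_setOf_eq, Complex.add_re, Complex.ofReal_re]
    linarith
  have hu_t : Tendsto u atTop (𝓝 z) := by
    have h0 : Tendsto (fun n : ℕ => (((1 / ((n : ℝ) + 1) : ℝ)) : ℂ)) atTop (𝓝 ((0 : ℝ) : ℂ)) :=
      (Complex.continuous_ofReal.tendsto 0).comp tendsto_one_div_add_atTop_nhds_zero_nat
    have := (tendsto_const_nhds (x := z) (f := (atTop : Filter ℕ))).add h0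
    rw [Complex.ofReal_zero, add_zero] at this
    exact this
  have hu_tw : Tendsto u atTop (𝓝[{τ : ℂ | 0 ≤ τ.re}] z) :=
    tendsto_nhdsWithin_iff.2 ⟨hu_t, Eventually.of_forall fun n =>
      show 0 ≤ (u n).re from le_of_lt (hu_mem n)⟩
  have hfc := (continuousOn_integral μ hEμ a z hz).tendsto.comp hu_tw
  have hgc := (continuousOn_integral ν hEν a z hz).tendsto.comp hu_tw
  have heq : f ∘ u = g ∘ u := funext fun n => hopen (hu_mem n)
  rw [heq] at hfc
  exact tendsto_nhds_unique hfc hgc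

/-- **Laplace–Fourier uniqueness on the half-space.** Two finite measures on energy–momentum space
`ℝ^d` carried by `{p₀ ≥ 0}` with the same data `∫ e^{−t p₀ + i⟨a,p⟩} dμ` for all `t ≥ 0` and all spatial
`a` (`a⁰ = 0`) are equal: for each `ξ` the transforms at `a = ξ − ξ₀e₀` agree on `Re z ≥ 0`
(`integral_eq_of_eq_ofReal`), in particular at `z = −iξ₀`, where they are the characteristic functions
(`charFun_eq_integral`); conclude by Lévy's uniqueness theorem `Measure.ext_of_charFun`. [folklore] -/
theorem measure_ext {μ ν : Measure (EuclideanSpace ℝ (Fin d))} [IsFiniteMeasure μ]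
    [IsFiniteMeasure ν] (hEμ : μ {p | p 0 < 0} = 0) (hEν : ν {p | p 0 < 0} = 0)
    (hLF : ∀ t : ℝ, 0 ≤ t → ∀ a : EuclideanSpace ℝ (Fin d), a 0 = 0 →
      ∫ p, cexp ((((-(t * p 0)) : ℝ) : ℂ) + ((⟪a, p⟫_ℝ : ℝ) : ℂ) * I) ∂μ =
        ∫ p, cexp ((((-(t * p 0)) : ℝ) : ℂ) + ((⟪a, p⟫_ℝ : ℝ) : ℂ) * I) ∂ν) :
    μ = ν := by
  refine Measure.ext_of_charFun (funext fun ξ => ?_)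
  set a : EuclideanSpace ℝ (Fin d) := ξ - (ξ 0) • EuclideanSpace.single 0 1 with ha
  have ha0 : a 0 = 0 := by simp [ha]
  rw [charFun_eq_integral μ ξ, charFun_eq_integral ν ξ]
  refine integral_eq_of_eq_ofReal hEμ hEν a (fun t ht => ?_) (by simp)
  rw [integral_ofReal, integral_ofReal]
  exact hLF t ht.le a ha0

end LaplaceFourierHalfSpace

/-! ## Joint spectral measures of `(H, P⃗)`: uniqueness, total mass, parallelogram and scaling laws -/

namespace OSReconstructionNoE1

variable {ι : Type u} {d : ℕ} [NeZero d] {S : LabelledSchwingerFamily ι (EuclideanSpace ℝ (Fin d))}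
variable {h : OSReconstructionNoE1 S}

omit [NeZero d] in
/-- `|e^{−t p₀ + i⟨a,p⟩}| = e^{−t p₀}` (real time; any coordinate index in place of `0`). [folklore] -/
theorem norm_jointSpectralKernel (t : ℝ) (a p : EuclideanSpace ℝ (Fin d)) (i : Fin d) :
    ‖cexp ((((-(t * p i)) : ℝ) : ℂ) + ((⟪a, p⟫_ℝ : ℝ) : ℂ) * I)‖ = Real.exp (-(t * p i)) := by
  rw [Complex.norm_exp]
  congr 1
  simp

/-- The Laplace–Fourier kernel `e^{−t p₀ + i⟨a,p⟩}` (`t ≥ 0`) is integrable against a joint spectral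
measure (finite, carried by `{p₀ ≥ 0}`, where the kernel is bounded by `1`). [folklore] -/
theorem IsJointSpectralMeasure.integrable {ψ : h.Hilbert} {μ : Measure (EuclideanSpace ℝ (Fin d))}
    (hμ : h.IsJointSpectralMeasure ψ μ) {t : ℝ} (ht : 0 ≤ t) (a : EuclideanSpace ℝ (Fin d)) :
    Integrable (fun p : EuclideanSpace ℝ (Fin d) =>
      cexp ((((-(t * p 0)) : ℝ) : ℂ) + ((⟪a, p⟫_ℝ : ℝ) : ℂ) * I)) μ := by
  haveI := hμ.isFiniteMeasure
  refine Integrable.mono' (integrable_const (1 : ℝ))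
    (by fun_prop : Continuous fun p : EuclideanSpace ℝ (Fin d) =>
      cexp ((((-(t * p 0)) : ℝ) : ℂ) + ((⟪a, p⟫_ℝ : ℝ) : ℂ) * I)).aestronglyMeasurable ?_
  filter_upwards [LaplaceFourierHalfSpace.ae_nonneg_apply_zero μ hμ.energy_nonneg] with p hp
  rw [norm_jointSpectralKernel, Real.exp_le_one_iff, neg_nonpos]
  exact mul_nonneg ht hp

/-- **Uniqueness of the joint spectral measure of `(H, P⃗)` at a vector**: two joint spectral measures
of the same `ψ` coincide (Laplace–Fourier uniqueness on `{p₀ ≥ 0}`, `LaplaceFourierHalfSpace.measure_ext`).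
On the operator side this is the uniqueness of the scalar measure `⟨ψ, E(·)ψ⟩` of the joint spectral
resolution of `(H, P⃗)`. [cite: ReedSimonI1980, Thm VIII.12] -/
theorem IsJointSpectralMeasure.unique {ψ : h.Hilbert} {μ ν : Measure (EuclideanSpace ℝ (Fin d))}
    (hμ : h.IsJointSpectralMeasure ψ μ) (hν : h.IsJointSpectralMeasure ψ ν) : μ = ν := by
  haveI := hμ.isFiniteMeasure
  haveI := hν.isFiniteMeasure
  exact LaplaceFourierHalfSpace.measure_ext hμ.energy_nonneg hν.energy_nonneg fun t ht a ha => by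
    rw [← hμ.inner_transfer_translate t ht a ha, ← hν.inner_transfer_translate t ht a ha]

/-- Every joint spectral measure of `ψ` is the chosen one `h.jointSpectralMeasure ψ`. [folklore] -/
theorem IsJointSpectralMeasure.eq_jointSpectralMeasure {ψ : h.Hilbert}
    {μ : Measure (EuclideanSpace ℝ (Fin d))} (hμ : h.IsJointSpectralMeasure ψ μ) :
    μ = h.jointSpectralMeasure ψ :=
  hμ.unique (h.isJointSpectralMeasure_jointSpectralMeasure ⟨μ, hμ⟩)

/-- **Total mass** `μ_ψ(ℝ^d) = ‖ψ‖²`, in `ℝ≥0∞`. [folklore] -/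
theorem IsJointSpectralMeasure.measure_univ {ψ : h.Hilbert} {μ : Measure (EuclideanSpace ℝ (Fin d))}
    (hμ : h.IsJointSpectralMeasure ψ μ) : μ univ = ENNReal.ofReal (‖ψ‖ ^ 2) := by
  haveI := hμ.isFiniteMeasure
  rw [← hμ.measureReal_univ, measureReal_def, ENNReal.ofReal_toReal (measure_ne_top _ _)]

/-- **Parallelogram law for joint spectral measures, as measures**:
`μ_{ψ+φ} + μ_{ψ−φ} = 2 • (μ_ψ + μ_φ)`. Both sides are finite, carried by `{p₀ ≥ 0}`, and have the same
Laplace–Fourier data, since `⟪ψ+φ, W(ψ+φ)⟫ + ⟪ψ−φ, W(ψ−φ)⟫ = 2⟪ψ, Wψ⟫ + 2⟪φ, Wφ⟫` for the linear map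
`W = e^{-tH} U(a⃗)`; conclude by `LaplaceFourierHalfSpace.measure_ext`. [folklore] -/
theorem IsJointSpectralMeasure.add_parallelogram {ψ φ : h.Hilbert}
    {μa μs μψ μφ : Measure (EuclideanSpace ℝ (Fin d))}
    (ha : h.IsJointSpectralMeasure (ψ + φ) μa) (hs : h.IsJointSpectralMeasure (ψ - φ) μs)
    (hψ : h.IsJointSpectralMeasure ψ μψ) (hφ : h.IsJointSpectralMeasure φ μφ) :
    μa + μs = (2 : ℝ≥0) • (μψ + μφ) := by
  haveI := ha.isFiniteMeasure
  haveI := hs.isFiniteMeasure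
  haveI := hψ.isFiniteMeasure
  haveI := hφ.isFiniteMeasure
  refine LaplaceFourierHalfSpace.measure_ext ?_ ?_ fun t ht a ha0 => ?_
  · simp [Measure.add_apply, ha.energy_nonneg, hs.energy_nonneg]
  · simp [Measure.smul_apply, Measure.add_apply, hψ.energy_nonneg, hφ.energy_nonneg]
  · rw [integral_add_measure (ha.integrable ht a) (hs.integrable ht a), integral_smul_nnreal_measure,
      integral_add_measure (hψ.integrable ht a) (hφ.integrable ht a),
      ← ha.inner_transfer_translate t ht a ha0, ← hs.inner_transfer_translate t ht a ha0,
      ← hψ.inner_transfer_translate t ht a ha0, ← hφ.inner_transfer_translate t ht a ha0]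
    simp only [map_add, map_sub, inner_add_left, inner_add_right, inner_sub_left, inner_sub_right]
    rw [NNReal.smul_def, Complex.real_smul]
    push_cast
    ring

/-- **Scaling law for joint spectral measures, as measures**: `μ_{cψ} = ‖c‖² • μ_ψ` (both sides have
the Laplace–Fourier data `|c|² ⟪ψ, e^{-tH}U(a⃗)ψ⟫`). [folklore] -/
theorem IsJointSpectralMeasure.eq_smul {ψ : h.Hilbert} (c : ℂ) {μc μψ : Measure (EuclideanSpace ℝ (Fin d))}
    (hc : h.IsJointSpectralMeasure (c • ψ) μc) (hψ : h.IsJointSpectralMeasure ψ μψ) :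
    μc = (‖c‖₊ ^ 2 : ℝ≥0) • μψ := by
  haveI := hc.isFiniteMeasure
  haveI := hψ.isFiniteMeasure
  refine LaplaceFourierHalfSpace.measure_ext hc.energy_nonneg ?_ fun t ht a ha0 => ?_
  · simp [Measure.smul_apply, hψ.energy_nonneg]
  · rw [integral_smul_nnreal_measure, ← hc.inner_transfer_translate t ht a ha0,
      ← hψ.inner_transfer_translate t ht a ha0]
    simp only [map_smul, inner_smul_left, inner_smul_right]
    rw [NNReal.smul_def, Complex.real_smul, ← mul_assoc]
    congr 1
    push_cast
    rw [mul_comm]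
    exact Complex.conj_mul' c

/-- **The joint spectral measure scales quadratically**: `‖c‖² • μ_ψ` is a joint spectral measure of
`c • ψ` whenever `μ_ψ` is one of `ψ` (no appeal to existence or uniqueness). [folklore] -/
theorem IsJointSpectralMeasure.smul {ψ : h.Hilbert} {μ : Measure (EuclideanSpace ℝ (Fin d))}
    (hμ : h.IsJointSpectralMeasure ψ μ) (c : ℂ) :
    h.IsJointSpectralMeasure (c • ψ) ((‖c‖₊ ^ 2 : ℝ≥0) • μ) := by
  haveI := hμ.isFiniteMeasure
  refine ⟨inferInstance, by simp [Measure.smul_apply, hμ.energy_nonneg], fun t ht a ha0 => ?_⟩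
  rw [integral_smul_nnreal_measure, ← hμ.inner_transfer_translate t ht a ha0]
  simp only [map_smul, inner_smul_left, inner_smul_right]
  rw [NNReal.smul_def, Complex.real_smul, ← mul_assoc]
  congr 1
  push_cast
  rw [mul_comm]
  exact Complex.conj_mul' c

end OSReconstructionNoE1

end Literature.MathematicalPhysics.QuantumFieldTheory
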